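import Mathlib
import HarnessLib
import Literature.MathematicalPhysics.StatisticalMechanics.TorusPolymerConnectivity
import Literature.Barriers.CriticalPhenomena.RigorousRGSmallParameterTorusGeometry
import Literature.Barriers.CriticalPhenomena.RigorousRGSmallParameterSmallSetNeighbourhood

/-!
# Centred versus corner blocks: strictly disjoint polymers are more than a block apart, and the
# connected components of a polymer are pairwise separated ([ABKM19] Ch. 6.2)

[ABKM19] pave the torus `(ℤ/M)^d` (`M = L^N`) by CENTRED cubes of side `s = L^k`
(`TorusPolymer.blockOf`), while the tree's Brydges–Slade polymer library
(`Literature.Barriers.CriticalPhenomena.LongRangePhi4.Polymer`) uses CORNER cubes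
(`block s x = {y : ⌊y_i/s⌋ = ⌊x_i/s⌋}` on representatives in `{0,…,M−1}`).  For `M = s·t` with
`s, t` odd the two pavings differ by the translation `c·𝟙`, `c = (M−1)/2 = (s−1)/2 + s·(t−1)/2`
(`translate_blockOf_eq_block`), so the library's torus geometry transfers:

* `tdist_eq_supNorm` — the library's torus distance is `|y − x|_∞` (`GradientFRD.supNorm`);
* `val_add_half`, `blockKey_add_half`, `sameBlock_iff_blockKey`, **`translate_blockOf_eq_block`**,
  **`isPolymer_iff_isPolymer_translate`** — the dictionary centred ↔ corner;
* **`separated_of_forall_not_adj`** — two `s`-polymers with no equal or `ℓ^∞`-adjacent points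
  ("strictly disjoint": their union is not connected) are `(s+1)`-separated: `dist_∞ > L^k`
  ([ABKM19] Ch. 6.2: "for `X, Y ∈ 𝓟_k` strictly disjoint we have `dist(X,Y) > L^k`"), from the
  library's `lt_tdist_of_forall_not_adj`;
* **`separated_of_mem_components`** — distinct connected components of a `k`-polymer are
  `(L^k+1)`-separated (they are polymers, disjoint, and non-adjacent by maximality);
* `subset_or_subset_of_isConn` — a connected set inside `X ∪ Y` with `dist_∞(X, Y) ≥ 2` lies in
  `X` or in `Y` (used for the decomposition `X = X₁ ∪ X₂` in the proof of Lemma 6.4 (5)).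

Everything is proved; no named fact.

## References
* S. Adams, S. Buchholz, R. Kotecký, S. Müller, arXiv:1910.13564, Ch. 6.2 (blocks, strictly
  disjoint polymers, `dist(X,Y) > L^k`, connected components) [AdamsBuchholzKoteckyMuller2019].
* D. C. Brydges, G. Slade, *A renormalisation group method. V*, J. Stat. Phys. 159 (2015), §1.2
  (polymers that do not touch) [BrydgesSlade2015RGV].
-/

noncomputable section

namespace Literature.MathematicalPhysics.StatisticalMechanics.TorusPolymer

open scoped BigOperators Classical
open Finset
open Literature.MathematicalPhysics.StatisticalMechanics.GradientFRD
  (natAbs_valMinAbs_le_supNorm supNorm_add_le supNorm_neg supNorm_eq_zero_iff)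
open Literature.Barriers.CriticalPhenomena.LongRangePhi4.Polymer
  (AdjInf ConnIn IsConn comp components mem_comp comp_subset mem_comp_self isConn_comp
    comp_disjoint_or_eq blockKey block mem_block tdist cycDist lt_tdist_of_forall_not_adj
    cycDist_eq_natAbs_valMinAbs)

variable {d M : ℕ} [NeZero M]

/-! ## The library's torus distance is the sup-norm of the difference -/

/-- `tdist x y = |y − x|_∞`. [cite: BrydgesSlade2015RGV, §1.2] -/
theorem tdist_eq_supNorm (x y : Fin d → ZMod M) : tdist x y = GradientFRD.supNorm (y - x) := by
  unfold tdist GradientFRD.supNorm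
  congr 1
  funext i
  rw [cycDist_eq_natAbs_valMinAbs, Pi.sub_apply]

/-! ## Centred blocks are translated corner blocks -/

/-- On an odd torus, `(y + (M−1)/2).val = ỹ + (M−1)/2` for the symmetric representative `ỹ` of `y`.
[cite: AdamsKoteckyMuller2016, Ch. 4] -/
theorem val_add_half (hM : Odd M) (y : ZMod M) :
    ((y + (((M - 1) / 2 : ℕ) : ZMod M)).val : ℤ) = y.valMinAbs + (((M - 1) / 2 : ℕ) : ℤ) := by
  have hy := natAbs_valMinAbs_le_half hM y
  obtain ⟨m, hm⟩ := hM
  have hhalf : (M - 1) / 2 = m := by omega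
  set u : ℤ := y.valMinAbs + (((M - 1) / 2 : ℕ) : ℤ) with hu
  have hu0 : 0 ≤ u := by rw [hu, hhalf]; omega
  have huM : u < M := by rw [hu, hhalf]; omega
  have hcast : (y + (((M - 1) / 2 : ℕ) : ZMod M)) = ((u.toNat : ℕ) : ZMod M) := by
    have h1 : ((u.toNat : ℕ) : ℤ) = u := Int.toNat_of_nonneg hu0
    have e : (y + (((M - 1) / 2 : ℕ) : ZMod M)) = ((u : ℤ) : ZMod M) := by
      rw [hu, Int.cast_add, ZMod.coe_valMinAbs, Int.cast_natCast]
    rw [e, ← h1]; norm_cast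
  rw [hcast, ZMod.val_natCast, Nat.mod_eq_of_lt (by omega), Int.toNat_of_nonneg hu0]

/-- **The corner-block key of the shifted point is the centred block index shifted by `(t−1)/2`**
(`M = s·t`, `s, t` odd; `(M−1)/2 = (s−1)/2 + s(t−1)/2`). [cite: AdamsKoteckyMuller2016, Ch. 4] -/
theorem blockKey_add_half {s t : ℕ} (hMst : M = s * t) (hs : Odd s) (ht : Odd t) (y : Fin d → ZMod M)
    (i : Fin d) :
    ((blockKey s (y + fun _ => (((M - 1) / 2 : ℕ) : ZMod M)) i : ℕ) : ℤ) =
      resIndex s (y i) + (((t - 1) / 2 : ℕ) : ℤ) := by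
  have hMo : Odd M := by rw [hMst]; exact hs.mul ht
  unfold blockKey
  simp only [Pi.add_apply]
  rw [Int.natCast_div, val_add_half hMo (y i)]
  obtain ⟨h, hs'⟩ := hs
  obtain ⟨m, ht'⟩ := ht
  have hh : (((M - 1) / 2 : ℕ) : ℤ) = h + s * m := by
    have : (M - 1) / 2 = h + s * m := by
      rw [hMst, hs', ht']; ring_nf; omega
    rw [this]; push_cast; ring
  have htm : (((t - 1) / 2 : ℕ) : ℤ) = m := by rw [ht']; push_cast; omega
  rw [hh, htm, resIndex]
  have hsh : (((s : ℤ)) - 1) / 2 = h := by rw [hs']; push_cast; omega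
  rw [hsh, show (y i).valMinAbs + ((h : ℤ) + s * m) = ((y i).valMinAbs + h) + s * m by ring]
  have hs0 : (s : ℤ) ≠ 0 := by rw [hs']; positivity
  rw [Int.add_mul_ediv_left _ _ hs0]

/-- `SameBlock s x y` iff the shifted points have the same corner key.
[cite: AdamsKoteckyMuller2016, Ch. 4] -/
theorem sameBlock_iff_blockKey {s t : ℕ} (hMst : M = s * t) (hs : Odd s) (ht : Odd t)
    (x y : Fin d → ZMod M) :
    SameBlock s x y ↔ blockKey s (x + fun _ => (((M - 1) / 2 : ℕ) : ZMod M)) =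
      blockKey s (y + fun _ => (((M - 1) / 2 : ℕ) : ZMod M)) := by
  constructor
  · intro h
    funext i
    have := h i
    rw [cubeIndex_eq_resIndex, cubeIndex_eq_resIndex] at this
    have e := blockKey_add_half hMst hs ht x i
    have e' := blockKey_add_half hMst hs ht y i
    rw [this] at e
    exact_mod_cast e.trans e'.symm
  · intro h i
    rw [cubeIndex_eq_resIndex, cubeIndex_eq_resIndex]
    have e := blockKey_add_half hMst hs ht x i
    have e' := blockKey_add_half hMst hs ht y i
    rw [congrFun h i] at e
    linarith

/-- **Centred blocks are translated corner blocks**: `B_x + c𝟙 = block s (x + c𝟙)`, `c = (M−1)/2`.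
[cite: AdamsKoteckyMuller2016, Ch. 4] -/
theorem translate_blockOf_eq_block {s t : ℕ} (hMst : M = s * t) (hs : Odd s) (ht : Odd t)
    (x : Fin d → ZMod M) :
    translate (fun _ => (((M - 1) / 2 : ℕ) : ZMod M)) (blockOf s x) =
      block s (x + fun _ => (((M - 1) / 2 : ℕ) : ZMod M)) := by
  ext y
  rw [mem_translate, mem_blockOf, mem_block, sameBlock_iff_blockKey hMst hs ht, sub_add_cancel]
  exact eq_comm

/-- **Centred polymers are translated corner polymers.** [cite: AdamsKoteckyMuller2016, Ch. 4] -/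
theorem isPolymer_iff_isPolymer_translate {s t : ℕ} (hMst : M = s * t) (hs : Odd s) (ht : Odd t)
    (X : Finset (Fin d → ZMod M)) :
    IsPolymer s X ↔ Literature.Barriers.CriticalPhenomena.LongRangePhi4.Polymer.IsPolymer s
      (translate (fun _ => (((M - 1) / 2 : ℕ) : ZMod M)) X) := by
  set c : Fin d → ZMod M := fun _ => (((M - 1) / 2 : ℕ) : ZMod M)
  constructor
  · intro hX y hy
    have hy' := mem_translate.1 hy
    have : block s y = translate c (blockOf s (y - c)) := by
      rw [translate_blockOf_eq_block hMst hs ht, sub_add_cancel]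
    rw [this, translate_subset_translate_iff]
    exact hX _ hy'
  · intro hX x hx
    have h := hX (add_mem_translate_iff.2 hx : x + c ∈ translate c X)
    rw [← translate_blockOf_eq_block hMst hs ht, translate_subset_translate_iff] at h
    exact h

/-! ## Strictly disjoint polymers are more than a block apart -/

/-- **Strictly disjoint `k`-polymers have `dist_∞ > L^k`**: two `s`-polymers (`M = s·t`, `s, t`
odd) with no equal or `ℓ^∞`-adjacent pair of points are `(s+1)`-separated.
[cite: AdamsBuchholzKoteckyMuller2019, Ch. 6.2] -/
theorem separated_of_forall_not_adj {s t : ℕ} (hMst : M = s * t) (hs : Odd s) (ht : Odd t)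
    {X Y : Finset (Fin d → ZMod M)} (hX : IsPolymer s X) (hY : IsPolymer s Y)
    (h : ∀ p ∈ X, ∀ q ∈ Y, ¬ (p = q ∨ AdjInf p q)) : Separated (s + 1) X Y := by
  set c : Fin d → ZMod M := fun _ => (((M - 1) / 2 : ℕ) : ZMod M)
  have hs0 : 0 < s := by obtain ⟨k, rfl⟩ := hs; omega
  have hsM : s ∣ M := ⟨t, hMst⟩
  have hX' := (isPolymer_iff_isPolymer_translate hMst hs ht X).1 hX
  have hY' := (isPolymer_iff_isPolymer_translate hMst hs ht Y).1 hY
  have h' : ∀ p ∈ translate c X, ∀ q ∈ translate c Y, ¬ (p = q ∨ AdjInf p q) := by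
    intro p hp q hq hpq
    refine h (p - c) (mem_translate.1 hp) (q - c) (mem_translate.1 hq) ?_
    rcases hpq with hpq | hpq
    · exact Or.inl (by rw [hpq])
    · right
      have := (adjInf_add_iff (-c)).2 hpq
      simpa [sub_eq_add_neg] using this
  intro u hu v hv
  have hlt := lt_tdist_of_forall_not_adj hs0 hsM hX' hY' h' (add_mem_translate_iff.2 hu)
    (add_mem_translate_iff.2 hv)
  rw [tdist_eq_supNorm, add_sub_add_right_eq_sub, ← GradientFRD.supNorm_neg, neg_sub] at hlt
  exact hlt

omit [NeZero M] in
/-- Adjacent points of `X` lie in the same connected component.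
[cite: AdamsBuchholzKoteckyMuller2019, Ch. 6.2] -/
theorem mem_comp_of_adjInf {X : Finset (Fin d → ZMod M)} {a x y : Fin d → ZMod M}
    (hx : x ∈ comp X a) (hy : y ∈ X) (hxy : AdjInf x y) : y ∈ comp X a := by
  obtain ⟨hxX, hax⟩ := mem_comp.1 hx
  exact mem_comp.2 ⟨hy, hax.tail ⟨hxX, hy, hxy⟩⟩

/-- **Distinct connected components of a `k`-polymer are `(L^k+1)`-separated** (odd torus
`M = s·t`). [cite: AdamsBuchholzKoteckyMuller2019, Ch. 6.2] -/
theorem separated_of_mem_components {s t : ℕ} (hMst : M = s * t) (hs : Odd s) (ht : Odd t)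
    {X Y₁ Y₂ : Finset (Fin d → ZMod M)} (hX : IsPolymer s X) (hY₁ : Y₁ ∈ components X)
    (hY₂ : Y₂ ∈ components X) (hne : Y₁ ≠ Y₂) : Separated (s + 1) Y₁ Y₂ := by
  have hMo : Odd M := by rw [hMst]; exact hs.mul ht
  obtain ⟨a₁, ha₁, rfl⟩ := mem_image.1 hY₁
  obtain ⟨a₂, ha₂, rfl⟩ := mem_image.1 hY₂
  have hdis : Disjoint (comp X a₁) (comp X a₂) :=
    (comp_disjoint_or_eq X a₁ a₂).resolve_left hne
  refine separated_of_forall_not_adj hMst hs ht (hX.comp hMo hs a₁) (hX.comp hMo hs a₂) ?_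
  intro p hp q hq hpq
  rcases hpq with rfl | hpq
  · exact Finset.disjoint_left.1 hdis hp hq
  · have hq' : q ∈ comp X a₁ := mem_comp_of_adjInf hp (comp_subset X a₂ hq) hpq
    exact Finset.disjoint_left.1 hdis hq' hq

/-- The components of a polymer are pairwise `(L^k+1)`-separated.
[cite: AdamsBuchholzKoteckyMuller2019, Ch. 6.2] -/
theorem pairwise_separated_components {s t : ℕ} (hMst : M = s * t) (hs : Odd s) (ht : Odd t)
    {X : Finset (Fin d → ZMod M)} (hX : IsPolymer s X) :
    (components X : Set (Finset (Fin d → ZMod M))).Pairwise (Separated (s + 1)) :=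
  fun _ hY₁ _ hY₂ hne => separated_of_mem_components hMst hs ht hX hY₁ hY₂ hne

/-! ## Connected sets do not straddle separated sets -/

omit [NeZero M] in
/-- Frontier crossing along a path. [folklore] -/
private theorem exists_step_of_reflTransGen' {α : Type*} {R : α → α → Prop} {S : Set α} {x y : α}
    (h : Relation.ReflTransGen R x y) (hx : x ∉ S) (hy : y ∈ S) :
    ∃ a c, R a c ∧ a ∉ S ∧ c ∈ S := by
  induction h with
  | refl => exact absurd hy hx
  | @tail b z _ hbz ih =>
    by_cases hb : b ∈ S
    · exact ih hb
    · exact ⟨b, z, hbz, hb, hy⟩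

/-- **A connected set inside `X ∪ Y` with `dist_∞(X, Y) ≥ 2` lies inside `X` or inside `Y`.**
[cite: AdamsBuchholzKoteckyMuller2019, Lemma 6.4 (proof: the decomposition X = X₁ ∪ X₂)] -/
theorem subset_or_subset_of_isConn {Z X Y : Finset (Fin d → ZMod M)} (hZ : IsConn Z)
    (hZXY : Z ⊆ X ∪ Y) (hsep : Separated 2 X Y) : Z ⊆ X ∨ Z ⊆ Y := by
  obtain ⟨z₀, hz₀⟩ := hZ.1
  have key : ∀ {A B : Finset (Fin d → ZMod M)}, Separated 2 A B → Z ⊆ A ∪ B → z₀ ∈ A → Z ⊆ A := by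
    intro A B hAB hZAB hzA z hz
    by_contra hzA'
    have hzB : z ∈ B := by
      rcases mem_union.1 (hZAB hz) with h | h
      · exact absurd h hzA'
      · exact h
    set S : Set (Fin d → ZMod M) := {w | w ∈ B}
    have hz₀S : z₀ ∉ S := fun h => by
      have := hAB z₀ hzA z₀ h
      rw [sub_self, GradientFRD.supNorm] at this
      simp [ZMod.valMinAbs_zero] at this
    obtain ⟨a, c, hac, haS, hcS⟩ := exists_step_of_reflTransGen' (hZ.2 z₀ hz₀ z hz) hz₀S hzB
    have haA : a ∈ A := by
      rcases mem_union.1 (hZAB hac.1) with h | h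
      · exact h
      · exact absurd h haS
    have h1 := hAB a haA c hcS
    have h2 := supNorm_sub_le_one_of_adjInf hac.2.2
    omega
  rcases mem_union.1 (hZXY hz₀) with h | h
  · exact Or.inl (key hsep hZXY h)
  · refine Or.inr (key hsep.symm ?_ h)
    rwa [union_comm]

end Literature.MathematicalPhysics.StatisticalMechanics.TorusPolymer

end
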